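import Summits.BirchSwinnertonDyer.BirchSwinnertonDyer.Theorems.KolyvaginRankRigidityAtTwoSignedRefillLaw
import Summits.BirchSwinnertonDyer.BirchSwinnertonDyer.Theorems.KolyvaginRankRigidityAtTwoWalkStepSign
import Summits.BirchSwinnertonDyer.BirchSwinnertonDyer.Theorems.KolyvaginRankRigidityAtTwoSwapKummerEigenLinesOfIndexAtTwo
import HarnessLib

/-!
# Crux U1 `KolyvaginBoundedDefectAtTwo` (stmt-BirchSwinnertonDyer-28083), LINE 17 `kolyvagin_swap` —
# the SIGNED REFILL LAW IN SITU: at ANY Kolyvagin place `v ∣ ℓ ∣ c` of index `≥ k + 1` (no regularity, Zhang's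
# numerics only), if `2^a` kills the `s`-symmetrised images at `v` of the previous vertex `H¹_{𝓕(c)[v ↦ Kum_v]}`, the
# vertex `H¹_{𝓕(c)}` holds an EXACT `s`-eigenclass whose image at `v` has order `≥ 2^(k − a − 8)`

Width seat `bsd-line-krr2-p2` g18 (ONE READER on LINE 17; pen v7.7's typed sub-target SRS `SignedRefillSupplyAtTwo`
of SWα); `--supports stmt-BirchSwinnertonDyer-28083` (helper). THEOREMS ONLY: nothing here proves SRS, SWα, U1, a rung
or BSD. BSD is NOT proved.

## What
Frame of this lineage's step-local files (g13/g14: `…WalkStepSign`): `𝓛 = 𝓕(c) = selmerF W 2^k 𝒯 (placesDividing K c)`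
for a square-free Kolyvagin conductor `c` with all indices `≥ k + 1`, a place `v ∣ ℓ ∣ c` FIXED by `τ` (inert), the
Weil datum `e` (`τ`-equivariant at `v`) and the conjugation-compatible Poitou–Tate family `inv`; `loc = loc_v`,
`τ_* = conjActPlace τ`, `s = ±1`.
* `conjActPlace_mem_map_localization_relaxed_selmerF` — `X = loc_v(H¹_{𝓛[v ↦ ⊤]})` is `τ_*`-stable (transport of the
  hybrid conditions place by place; the relaxed place is `τ`-fixed).
* `exists_zsmul_two_eq_zsmul_of_kummer_eigen` — the Kummer `s`-eigen-part at `v` is «doubly cyclic»: `2f ∈ ℤ(2g)` for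
  every `f ∈ Kum_v` with `τ_* f = s f` (this lineage's `kummer_eigen_at_two_of_index`, g7, Zhang's numerics only, +
  `SwapPairing.exists_eq_zsmul_add_of_card_le_of_mem`: the eigen-part is `ℤg + 2`-torsion).
* **`exists_eigen_mem_selmerF_of_symmetrised_cut`** — THE SIGNED SUPPLY IN SITU: if every `y ∈ H¹_{𝓛[v ↦ Kum_v]}` has
  `2^a • (τ_*(loc y) + s • loc y) = 0` and `a + 8 ≤ k`, then some `t ∈ H¹_{𝓛}` has `conjAct τ t = s • t` (a GLOBAL exact
  `s`-eigenclass) and `2^(k − (a + 8)) • loc t ≠ 0`. Assembly of the abstract signed supply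
  (`exists_eigen_mem_inf_of_lagrangian_of_symmetrised`, file `…SignedRefillLaw`) on `L = H¹(K_v, E[2^k])`,
  `b = inv_v(· ∪ₑ ·)` (symmetric, non-degenerate, `τ_*`-invariant: `invWeilPairing_conjActPlace`), the Lagrangian pair
  `Kum_v ⊕ 𝒯_v` (`kummer_inf/sup_transverse_eq_*_two`, `transverse_isotropic_two`), the Lagrangian `X` (isotropic:
  `isotropic_map_localization_relaxed_selmerF`; `#X = #Kum_v`: `natCard_map_localization_relaxed_selmerF_eq`), the cut
  `X ∩ Kum_v = loc(H¹_{𝓛[v ↦ Kum_v]})`, the refill `X ∩ 𝒯_v = loc(H¹_{𝓛})`, the Kummer eigenclass of order `2^k`;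
  then global symmetrisation `t = conjAct τ t₀ + s t₀` of a preimage (one more bit).
In SRS (pen v7.7): `c = q·e`, `v ∣ q` the seed place, `H¹_{𝓛[v ↦ Kum_v]} = H_{𝓕(e)}`, `H¹_{𝓛} = H_{𝓕(qe)}` (g15's
`selmerGroup_update_kummer_eq_modifiedSelmerGroup`), and the cut hypothesis is the shape `Sh(0, a)` read through Φ-KILL.
References (locators only; no cited FACT is declared): [cite: MazurRubin2004, Prop. 1.3.2, §4.1 Prop. 4.1.5, Lemma 4.1.7]
[cite: Howard2004HeegnerKolyvagin, §1.5–1.6, Thm. 2.1.11] [cite: Jetchev2008, §3.2 (2), Prop. 4.2, Lemma 5.2 (iii)]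
[cite: GrossLMS1991, §3 (3.3)–(3.4)] [cite: MilneADT2006, Ch. I, Cor. 2.3, Thm. 4.10 (b)].
Design: no definitions; `K : Type`; axioms `propext`, `Classical.choice`, `Quot.sound`.
-/

set_option autoImplicit false
-- the Theorems namespace of this sub repeats the summit name by design (D-0017 nested layout)
set_option linter.dupNamespace false

noncomputable section

open scoped Classical
open Function NumberField IsDedekindDomain WeierstrassCurve Field
open Literature.NumberTheory.EllipticCurves Literature.NumberTheory.EllipticCurves.Jetchev2008
open Literature.NumberTheory.GaloisRepresentations Literature.NumberTheory.GaloisCohomology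
open Literature.NumberTheory.GaloisRepresentations.DiscreteGaloisModule (localTatePairingZMod tateDual
  transverseSubgroup SelmerStructure)
open Literature.NumberTheory.Automorphic
open Summit.BirchSwinnertonDyer.Rank1Residual
open Summit.BirchSwinnertonDyer.Rank1Residual.JET.RingClassTransverse
open Summit.BirchSwinnertonDyer.Rank1Residual.JET.SelmerVocabulary
open Summit.BirchSwinnertonDyer.Rank1Residual.X11b.Relaxation (invWeilPairing invWeilPairing_apply
  invWeilPairing_eq_zero_of_mem)
open Summit.BirchSwinnertonDyer.BirchSwinnertonDyer.Theorems.KolyvaginLowerBoundAtTwo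

namespace Summit.BirchSwinnertonDyer.BirchSwinnertonDyer.Theorems.KolyvaginAtTwo.RegularRefill

variable {K : Type} [Field K] [NumberField K] (W : WeierstrassCurve ℚ) [W.IsElliptic] [W.IsGloballyMinimal]
  (k : ℕ)
  (e : geomTorsion (W.baseChange K) ((2 ^ k : ℕ) : ℤ) → geomTorsion (W.baseChange K) ((2 ^ k : ℕ) : ℤ) →
    AlgebraicClosure K)
  (hμ : ∀ S T, e S T ^ (2 ^ k) = 1)
  (hadd₁ : ∀ S₁ S₂ T, e (S₁ + S₂) T = e S₁ T * e S₂ T)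
  (hadd₂ : ∀ S T₁ T₂, e S (T₁ + T₂) = e S T₁ * e S T₂)
  (hgal : ∀ (g : absoluteGaloisGroup K) (S T : geomTorsion (W.baseChange K) ((2 ^ k : ℕ) : ℤ)),
    g • e S T = e (g • S) (g • T))
  (halt : ∀ T, e T T = 1) (hnondeg : ∀ T, (∀ S, e S T = 1) → T = 0)
  (inv : LocalInvariants K (2 ^ k))
  (hK : IsImaginaryQuadratic K) (hD : NumberField.discr K < -4) (ι : K →+* ℂ)
  [∀ j : ℕ, NumberField (ringClassField K ι j)] (hk : 1 ≤ k)
  (c : ℕ) (hc : Squarefree c)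
  (hkol : ∀ ℓ ∈ c.primeFactors, Zhang2014.IsKolyvaginPrime (W.conductorNorm ℤ) W K 2 ℓ)
  (hkM : ∀ ℓ ∈ c.primeFactors, k + 1 ≤ Zhang2014.kolyvaginIndex W 2 ℓ)
  (𝒯 : SelmerStructure ((W.baseChange K).torsionGaloisModule ((2 ^ k : ℕ) : ℤ)))
  (h𝒯 : ∀ v : HeightOneSpectrum (𝓞 K), 𝒯 (Sum.inr v) =
    ⨅ ℓ ∈ c.primeFactors.filter (fun ℓ : ℕ ↦ ((ℓ : ℕ) : 𝓞 K) ∈ v.asIdeal),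
      ⨅ (w' : HeightOneSpectrum (𝓞 (ringClassField K ι ℓ))) (_ : w'.asIdeal.LiesOver v.asIdeal),
        letI := (adicCompletionOfLiesOver K (ringClassField K ι ℓ) v w').toAlgebra
        transverseSubgroup (GaloisRep.toLocal v ((W.baseChange K).torsionGaloisModule ((2 ^ k : ℕ) : ℤ)))
          (w'.adicCompletion (ringClassField K ι ℓ)))
  (hperf : inv.IsPerfect) (hvan : inv.SumLocalTermEqZero) (hcomp : inv.SelmerComplement)
  {ℓ : ℕ} (hℓc : ℓ ∈ c.primeFactors)
  (v : HeightOneSpectrum (𝓞 K)) (hv : (ℓ : 𝓞 K) ∈ v.asIdeal)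
  {τ : K ≃ₐ[ℚ] K} (hτ1 : τ ≠ 1) (hfix : τ • v = v) {s : ℤ} (hs : s = 1 ∨ s = -1)
  (hτe : ∀ S T, liftAutPlace τ hfix (e S T) =
    e ((isLiftOfAut_liftAutPlace τ hfix).torsionMap W (2 ^ k) S) ((isLiftOfAut_liftAutPlace τ hfix).torsionMap W (2 ^ k) T))
  (hinvc : inv.IsConjCompatible τ)

/-! ### §1 The relaxed image `X = loc_v(H¹_{𝓛[v ↦ ⊤]})` is `τ_*`-stable -/

include hK hc h𝒯 in
omit [W.IsElliptic] [W.IsGloballyMinimal] in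
/-- **`loc_v(H¹_{𝓕(c)[v ↦ ⊤]})` is `τ_*`-stable** at a `τ`-fixed place `v`: `H¹_{𝓕(c)[v ↦ ⊤]}` is `conjAct τ`-stable
(the hybrid conditions are transported place by place, `JET.GlobalDuality.conjActPlace_mem_selmerF` with the `τ`-stable
transverse family; the relaxed place `v` is fixed, so a place `≠ v` is carried to a place `≠ v`), and
`τ_* ∘ loc_v = loc_v ∘ conjAct τ` (`conjActPlace_localization`). [cite: Jetchev2008, §4.3] [cite: GrossLMS1991, §5 (5.1)] -/
theorem conjActPlace_mem_map_localization_relaxed_selmerF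
    {x : galoisCohomology ((((W.baseChange K).torsionGaloisModule ((2 ^ k : ℕ) : ℤ))).toLocal (Sum.inr v : Place K)) 1}
    (hx : x ∈ (SelmerStructure.selmerGroup (Function.update (selmerF W ((2 ^ k : ℕ) : ℤ) 𝒯 (placesDividing K c))
          (Sum.inr v : Place K) ⊤ : SelmerStructure ((W.baseChange K).torsionGaloisModule ((2 ^ k : ℕ) : ℤ)))).map
        (galoisCohomology.localization ((W.baseChange K).torsionGaloisModule ((2 ^ k : ℕ) : ℤ)) (Sum.inr v : Place K) 1)) :
    conjActPlace W τ ((2 ^ k : ℕ) : ℤ) hfix x ∈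
      (SelmerStructure.selmerGroup (Function.update (selmerF W ((2 ^ k : ℕ) : ℤ) 𝒯 (placesDividing K c))
          (Sum.inr v : Place K) ⊤ : SelmerStructure ((W.baseChange K).torsionGaloisModule ((2 ^ k : ℕ) : ℤ)))).map
        (galoisCohomology.localization ((W.baseChange K).torsionGaloisModule ((2 ^ k : ℕ) : ℤ)) (Sum.inr v : Place K) 1) := by
  obtain ⟨y, hy, rfl⟩ := AddSubgroup.mem_map.mp hx
  refine AddSubgroup.mem_map.mpr ⟨conjAct W τ ((2 ^ k : ℕ) : ℤ) y, ?_, (conjActPlace_localization W τ ((2 ^ k : ℕ) : ℤ) hfix y).symm⟩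
  refine JET.GlobalDuality.conjAct_mem_selmerGroup_of_transport W τ ((2 ^ k : ℕ) : ℤ) _ (fun v' w h z hz ↦ ?_)
    (fun w ↦ JET.GlobalDuality.addSubgroup_galoisCohomology_inl_eq_top_of_isComplex _ (hK.2.isComplex w) _) hy
  by_cases hw : w = v
  · subst hw
    rw [Function.update_self]
    trivial
  · have hv' : v' ≠ v := by
      rintro rfl
      exact hw (h.symm.trans hfix)
    have hne' : (Sum.inr v' : Place K) ≠ Sum.inr v := fun h' ↦ hv' (Sum.inr_injective h')
    have hne : (Sum.inr w : Place K) ≠ Sum.inr v := fun h' ↦ hw (Sum.inr_injective h')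
    rw [Function.update_of_ne hne'] at hz
    rw [Function.update_of_ne hne]
    exact JET.GlobalDuality.conjActPlace_mem_selmerF W τ ((2 ^ k : ℕ) : ℤ) 𝒯 hc.ne_zero
      (fun v'' w' h' hv'' y' hy' ↦ JET.forall_conjActPlace_mem_of_eq_iInf_transverseSubgroup W hK ι τ
        ((2 ^ k : ℕ) : ℤ) c 𝒯 h𝒯 v'' w' h' hv'' y' hy') v' w h z hz

/-! ### §2 The Kummer `s`-eigen-part at `v` is doubly cyclic -/

include hK hk hkol hkM hℓc hv hτ1 hs in
/-- **`2 · Kum_v^{τ_* = s} ⊆ ℤ(2g)`** at a Kolyvagin place of index `≥ k + 1` (Zhang's numerics only): the `s`-eigen-part of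
`τ_*` on `Kum_v` has `≤ 2^(k+1)` elements and a class `g` of order `2^k` (`kummer_eigen_at_two_of_index`), hence is
`ℤg + (2-torsion)` (`SwapPairing.exists_eq_zsmul_add_of_card_le_of_mem`), so `2f ∈ ℤ(2g)` for each of its elements `f`;
and `2^(k−2) • (τ_* g + s • g) ≠ 0`. [cite: Jetchev2008, §3.2 (2), Prop. 4.2] [cite: GrossLMS1991, §3 (3.3)–(3.4)] -/
theorem exists_zsmul_two_eq_zsmul_of_kummer_eigen (hk2 : 2 ≤ k) :
    ∃ g : galoisCohomology ((((W.baseChange K).torsionGaloisModule ((2 ^ k : ℕ) : ℤ))).toLocal (Sum.inr v : Place K)) 1,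
      g ∈ (W.baseChange K).kummerSelmerStructure ((2 ^ k : ℕ) : ℤ) (Sum.inr v : Place K) ∧
      (2 : ℤ) ^ (k - 2) • (conjActPlace W τ ((2 ^ k : ℕ) : ℤ) hfix g + s • g) ≠ 0 ∧
      ∀ f ∈ (W.baseChange K).kummerSelmerStructure ((2 ^ k : ℕ) : ℤ) (Sum.inr v : Place K),
        conjActPlace W τ ((2 ^ k : ℕ) : ℤ) hfix f = s • f → ∃ c' : ℤ, (2 : ℤ) • f = c' • ((2 : ℤ) • g) := by
  haveI : Finite (geomTorsion (W.baseChange K) ((2 ^ k : ℕ) : ℤ)) :=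
    finite_torsionPoints_holds (W.baseChange K) (AlgebraicClosure K) (by positivity)
  haveI : Finite (galoisCohomology ((((W.baseChange K).torsionGaloisModule ((2 ^ k : ℕ) : ℤ))).toLocal
      (Sum.inr v : Place K)) 1) := finite_galoisCohomology_one_toLocal _ v
  have hℓ := hkol ℓ hℓc
  obtain ⟨hcount, g, hgmem, hgne⟩ := kummer_eigen_at_two_of_index W K hK hk hℓ (hkM ℓ hℓc) v hv hτ1 hfix hs
  set Kum := (W.baseChange K).kummerSelmerStructure ((2 ^ k : ℕ) : ℤ) (Sum.inr v : Place K) with hKum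
  set E := (conjActPlace W τ ((2 ^ k : ℕ) : ℤ) hfix - s • AddMonoidHom.id _).ker with hE
  have hmemS : ∀ {y}, y ∈ Kum ⊓ E ↔ y ∈ Kum ∧ conjActPlace W τ ((2 ^ k : ℕ) : ℤ) hfix y = s • y := fun {y} ↦ by
    rw [AddSubgroup.mem_inf, hE, AddMonoidHom.mem_ker, AddMonoidHom.sub_apply, AddMonoidHom.smul_apply,
      AddMonoidHom.id_apply, sub_eq_zero]
  obtain ⟨hgK, hgeig⟩ := hmemS.mp hgmem
  have hexp : ∀ x : galoisCohomology ((((W.baseChange K).torsionGaloisModule ((2 ^ k : ℕ) : ℤ))).toLocal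
      (Sum.inr v : Place K)) 1, (2 : ℤ) ^ k • x = 0 := fun x ↦ by
    have h := X11b.KummerPT.nsmul_galoisCohomology_toLocal_eq_zero (W.baseChange K) (2 ^ k) (Sum.inr v) x
    have e2k : ((2 : ℤ) ^ k) = ((2 ^ k : ℕ) : ℤ) := by rw [Nat.cast_pow, Nat.cast_ofNat]
    rw [e2k, natCast_zsmul]; exact h
  have hgz : (2 : ℤ) ^ (k - 1) • g ≠ 0 := by
    rw [← natCast_zsmul] at hgne
    exact_mod_cast hgne
  have hSfin : ((Kum ⊓ E : AddSubgroup _) : Set (galoisCohomology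
      ((((W.baseChange K).torsionGaloisModule ((2 ^ k : ℕ) : ℤ))).toLocal (Sum.inr v : Place K)) 1)).Finite :=
    Set.toFinite _
  refine ⟨g, hgK, ?_, fun f hf hfe ↦ ?_⟩
  · -- `2^(k-2) • (τ_* g + s g) = s • 2^(k-1) • g ≠ 0`
    have hss : s * s = 1 := by rcases hs with rfl | rfl <;> norm_num
    rw [hgeig, ← two_zsmul, smul_smul, smul_smul]
    have hk1 : (2 : ℤ) ^ (k - 2) * 2 * s = s * (2 : ℤ) ^ (k - 1) := by
      have : k - 1 = (k - 2) + 1 := by omega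
      rw [this, pow_succ]; ring
    rw [hk1, mul_smul]
    intro h0
    apply hgz
    have h1 : s • (s • ((2 : ℤ) ^ (k - 1) • g)) = s • (0 : galoisCohomology
        ((((W.baseChange K).torsionGaloisModule ((2 ^ k : ℕ) : ℤ))).toLocal (Sum.inr v : Place K)) 1) :=
      congrArg (fun z ↦ s • z) h0
    rwa [smul_smul, hss, one_smul, smul_zero] at h1
  · obtain ⟨c', t, -, ht2, hfe'⟩ := SwapPairing.exists_eq_zsmul_add_of_card_le_of_mem hk _ hSfin hcount
      (fun y hy ↦ hexp y) hgmem hgz (hmemS.mpr ⟨hf, hfe⟩)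
    refine ⟨c', ?_⟩
    rw [hfe', smul_add, ht2, add_zero, smul_smul, smul_smul, mul_comm]

/-! ### §3 The signed supply in situ -/

include hμ hadd₁ hadd₂ hgal halt hnondeg hK hD hk hc hkol hkM h𝒯 hperf hvan hcomp hℓc hv hτ1 hs hτe hinvc in
/-- **THE SIGNED SUPPLY IN SITU.** In the frame of this file, suppose every `y` of the previous vertex
`H¹_{𝓛[v ↦ Kum_v]}` (`𝓛 = 𝓕(c)`) has `2^a • (τ_*(loc_v y) + s • loc_v y) = 0` (the `s`-part of its image at `v` is small
up to phantoms) and `a + 8 ≤ k`. Then some `t ∈ H¹_{𝓛}` is a GLOBAL exact `s`-eigenclass (`conjAct τ t = s • t`) with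
`2^(k − (a + 8)) • loc_v t ≠ 0`. See the module docstring. [cite: MazurRubin2004, §4.1 Prop. 4.1.5, Lemma 4.1.7]
[cite: Howard2004HeegnerKolyvagin, §1.5–1.6, Thm. 2.1.11] [cite: Jetchev2008, Lemma 5.2 (iii)] -/
theorem exists_eigen_mem_selmerF_of_symmetrised_cut [NeZero (2 ^ k)]
    [Finite (geomTorsion (W.baseChange K) ((2 ^ k : ℕ) : ℤ))] {a : ℕ} (hak : a + 8 ≤ k)
    (hcut : ∀ y ∈ (SelmerStructure.selmerGroup (Function.update (selmerF W ((2 ^ k : ℕ) : ℤ) 𝒯 (placesDividing K c))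
        (Sum.inr v : Place K) ((W.baseChange K).kummerSelmerStructure ((2 ^ k : ℕ) : ℤ) (Sum.inr v : Place K)) :
        SelmerStructure ((W.baseChange K).torsionGaloisModule ((2 ^ k : ℕ) : ℤ)))),
      (2 : ℤ) ^ a • (conjActPlace W τ ((2 ^ k : ℕ) : ℤ) hfix
          (galoisCohomology.localization ((W.baseChange K).torsionGaloisModule ((2 ^ k : ℕ) : ℤ)) (Sum.inr v : Place K) 1 y) +
        s • galoisCohomology.localization ((W.baseChange K).torsionGaloisModule ((2 ^ k : ℕ) : ℤ))
          (Sum.inr v : Place K) 1 y) = 0) :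
    ∃ t : galH1Torsion (W.baseChange K) ((2 ^ k : ℕ) : ℤ),
      t ∈ (selmerF W ((2 ^ k : ℕ) : ℤ) 𝒯 (placesDividing K c)).selmerGroup ∧
      conjAct W τ ((2 ^ k : ℕ) : ℤ) t = s • t ∧
      (2 : ℤ) ^ (k - (a + 8)) • galoisCohomology.localization ((W.baseChange K).torsionGaloisModule ((2 ^ k : ℕ) : ℤ))
        (Sum.inr v : Place K) 1 t ≠ 0 := by
  haveI : Finite (galoisCohomology ((((W.baseChange K).torsionGaloisModule ((2 ^ k : ℕ) : ℤ))).toLocal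
      (Sum.inr v : Place K)) 1) := finite_galoisCohomology_one_toLocal _ v
  haveI : ∀ w : Place K, CompactSpace (absoluteGaloisGroup (Place.Completion w)) :=
    fun w ↦ absoluteGaloisGroup_compactSpace _
  have hinv : Injective (inv (Sum.inr v)) := (hperf v).1.1
  have hvc : v ∈ placesDividing K c := mem_placesDividing_of_mem_primeFactors hc hℓc v hv
  have hττ : τ * τ = 1 := by
    haveI : Algebra.IsQuadraticExtension ℚ K := ⟨hK.1⟩
    have hcard : Nat.card (K ≃ₐ[ℚ] K) = 2 := by rw [IsGalois.card_aut_eq_finrank, hK.1]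
    haveI : Finite (K ≃ₐ[ℚ] K) := Nat.finite_of_card_ne_zero (by rw [hcard]; decide)
    have h : τ ^ Nat.card (K ≃ₐ[ℚ] K) = 1 := pow_card_eq_one'
    rw [hcard, pow_two] at h
    exact h
  have hss : s * s = 1 := by rcases hs with rfl | rfl <;> norm_num
  set 𝓛 := selmerF W ((2 ^ k : ℕ) : ℤ) 𝒯 (placesDividing K c) with h𝓛
  set loc := galoisCohomology.localization ((W.baseChange K).torsionGaloisModule ((2 ^ k : ℕ) : ℤ))
    (Sum.inr v : Place K) 1 with hloc
  set Rel := SelmerStructure.selmerGroup (Function.update 𝓛 (Sum.inr v : Place K) ⊤ :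
    SelmerStructure ((W.baseChange K).torsionGaloisModule ((2 ^ k : ℕ) : ℤ))) with hRel
  set Kum := (W.baseChange K).kummerSelmerStructure ((2 ^ k : ℕ) : ℤ) (Sum.inr v : Place K) with hKum
  set σ := conjActPlace W τ ((2 ^ k : ℕ) : ℤ) hfix with hσ
  -- `S' = H¹_{𝓛} = Rel ⊓ loc⁻¹ 𝒯_v` and `S = H¹_{𝓛[v ↦ Kum]} = Rel ⊓ loc⁻¹ Kum`
  have h𝓛v : 𝓛 (Sum.inr v) = 𝒯 (Sum.inr v) := by rw [h𝓛, selmerF_inr, if_pos hvc]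
  have hS' : 𝓛.selmerGroup = Rel ⊓ (𝒯 (Sum.inr v)).comap loc := by
    have h := selmerGroup_update_eq_inf_comap W k 𝓛 v (𝒯 (Sum.inr v))
    have hupd : Function.update 𝓛 (Sum.inr v : Place K) (𝒯 (Sum.inr v)) = 𝓛 := by
      rw [← h𝓛v, Function.update_eq_self]
    rw [hupd] at h
    exact h
  have hS : SelmerStructure.selmerGroup (Function.update 𝓛 (Sum.inr v : Place K) Kum :
      SelmerStructure ((W.baseChange K).torsionGaloisModule ((2 ^ k : ℕ) : ℤ))) = Rel ⊓ Kum.comap loc :=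
    selmerGroup_update_eq_inf_comap W k 𝓛 v Kum
  -- the abstract data
  have hcutX : ∀ y ∈ Rel.map loc ⊓ Kum, (2 : ℤ) ^ a • (σ y + s • y) = 0 := by
    intro y hy
    obtain ⟨hyX, hyK⟩ := AddSubgroup.mem_inf.mp hy
    obtain ⟨z, hz, rfl⟩ := AddSubgroup.mem_map.mp hyX
    have hzS : z ∈ (SelmerStructure.selmerGroup (Function.update 𝓛 (Sum.inr v : Place K) Kum :
        SelmerStructure ((W.baseChange K).torsionGaloisModule ((2 ^ k : ℕ) : ℤ)))) := by
      rw [hS]; exact AddSubgroup.mem_inf.mpr ⟨hz, AddSubgroup.mem_comap.mpr hyK⟩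
    exact hcut z hzS
  obtain ⟨g, hgK, hgbig, hline⟩ := exists_zsmul_two_eq_zsmul_of_kummer_eigen W k hK hk c hkol hkM hℓc v hv hτ1
    hfix hs (by omega)
  have hbig : ∃ k' ∈ Kum, (2 : ℤ) ^ (k - 2) • (σ k' + s • k') ≠ 0 := ⟨g, hgK, hgbig⟩
  have hae : a + 5 ≤ k - 2 := by omega
  obtain ⟨z, hz, hzeig, hzne⟩ := exists_eigen_mem_inf_of_lagrangian_of_symmetrised
    (invWeilPairing (W.baseChange K) (2 ^ k) e hμ hadd₁ hadd₂ hgal inv (Sum.inr v))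
    (X11b.KummerPT.nsmul_galoisCohomology_toLocal_eq_zero (W.baseChange K) (2 ^ k) (Sum.inr v))
    (fun x y ↦ AdditiveKoly.LagrangianSwitchAtP.invWeilPairing_symm (W.baseChange K) (2 ^ k) e hμ hadd₁ hadd₂ hgal
      halt inv (Sum.inr v) x y)
    (kummer_inf_transverse_eq_bot_two W k hK hD ι hk c hc hkol hkM 𝒯 h𝒯 v hvc)
    (kummer_sup_transverse_eq_top_two W k hK hD ι hk c hc hkol hkM 𝒯 h𝒯 v hvc)
    (fun x hx y hy ↦ invWeilPairing_eq_zero_of_mem (W.baseChange K) (2 ^ k) e hμ hadd₁ hadd₂ hgal halt inv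
      (Sum.inr v) hx hy)
    (fun x hx y hy ↦ transverse_isotropic_two W k e hμ hadd₁ hadd₂ hgal halt hnondeg inv hK hD ι hk c hc hkol hkM 𝒯
      h𝒯 hperf v hvc hx hy)
    σ (fun x ↦ conjActPlace_conjActPlace W τ ((2 ^ k : ℕ) : ℤ) hττ hfix hfix x)
    (fun x y ↦ invWeilPairing_conjActPlace W τ (2 ^ k) e hμ hadd₁ hadd₂ hgal inv hinvc hfix hτe x y)
    (fun f hf ↦ conjActPlace_mem_kummerSelmerStructure W τ ((2 ^ k : ℕ) : ℤ) hfix hf)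
    (fun x hx ↦ JET.forall_conjActPlace_mem_of_eq_iInf_transverseSubgroup W hK ι τ ((2 ^ k : ℕ) : ℤ) c 𝒯 h𝒯 v v
      hfix hvc x hx)
    hs (invWeilPairing_injective_of_symm W k e hμ hadd₁ hadd₂ hgal halt hnondeg inv v hinv) (Rel.map loc)
    (isotropic_map_localization_relaxed_selmerF W k e hμ hadd₁ hadd₂ hgal halt hnondeg inv hK hD ι hk c hc hkol hkM 𝒯
      h𝒯 hperf hvan v hvc)
    (natCard_map_localization_relaxed_selmerF_eq W k e hμ hadd₁ hadd₂ hgal halt hnondeg inv hK hD ι hk c hc hkol hkM 𝒯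
      h𝒯 hperf hvan hcomp v hvc)
    (fun x hx ↦ conjActPlace_mem_map_localization_relaxed_selmerF W k hK ι c hc 𝒯 h𝒯 v hfix hx)
    ⟨(2 : ℤ) • g, fun f hf hfe ↦ hline f hf hfe⟩ hae hcutX hbig
  -- `z = loc t₀` with `t₀ ∈ H¹_{𝓛}`
  obtain ⟨hzX, hzT⟩ := AddSubgroup.mem_inf.mp hz
  obtain ⟨t₁, ht₁, ht₁z⟩ := AddSubgroup.mem_map.mp hzX
  obtain ⟨t₀, rfl⟩ : ∃ t₀ : galH1Torsion (W.baseChange K) ((2 ^ k : ℕ) : ℤ), t₀ = t₁ := ⟨t₁, rfl⟩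
  have ht₀S : t₀ ∈ 𝓛.selmerGroup := by
    rw [hS']; exact AddSubgroup.mem_inf.mpr ⟨ht₁, AddSubgroup.mem_comap.mpr (ht₁z ▸ hzT)⟩
  -- the global symmetrisation `t = conjAct τ t₀ + s • t₀`
  refine ⟨conjAct W τ ((2 ^ k : ℕ) : ℤ) t₀ + s • t₀,
    AddSubgroup.add_mem _ (conjAct_mem_selmerGroup_selmerF W k hK ι c hc 𝒯 h𝒯 ht₀S τ) (AddSubgroup.zsmul_mem _ ht₀S s),
    ?_, ?_⟩
  · rw [map_add, map_zsmul, conjAct_conjAct_of_mul_self W hττ]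
    rcases hs with rfl | rfl
    · simp only [one_zsmul]
      exact add_comm _ _
    · simp only [neg_one_zsmul, neg_add, neg_neg]
      exact add_comm _ _
  · -- atoms: `u = loc t₀ = z`
    have e1 : loc (conjAct W τ ((2 ^ k : ℕ) : ℤ) t₀ + s • t₀) =
        loc (conjAct W τ ((2 ^ k : ℕ) : ℤ) t₀) + loc (s • t₀) := map_add _ _ _
    have e2 : loc (s • t₀) = s • loc t₀ := map_zsmul _ _ _
    have e3 : σ (loc t₀) = loc (conjAct W τ ((2 ^ k : ℕ) : ℤ) t₀) := conjActPlace_localization W τ _ hfix t₀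
    have hloct₀ : loc t₀ = z := ht₁z
    have hkey : loc (conjAct W τ ((2 ^ k : ℕ) : ℤ) t₀ + s • t₀) = (2 * s) • z := by
      rw [e1, e2, ← e3, hloct₀, hzeig, ← two_zsmul, smul_smul]
    have hexp2 : (2 : ℤ) ^ (k - (a + 8)) * (2 * s) = s * (2 : ℤ) ^ (k - 2 - (a + 5)) := by
      have : k - 2 - (a + 5) = (k - (a + 8)) + 1 := by omega
      rw [this, pow_succ]; ring
    intro h0
    rw [hkey, smul_smul, hexp2, mul_smul] at h0
    apply hzne
    have h1 : s • (s • ((2 : ℤ) ^ (k - 2 - (a + 5)) • z)) = s • (0 : galoisCohomology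
        ((((W.baseChange K).torsionGaloisModule ((2 ^ k : ℕ) : ℤ))).toLocal (Sum.inr v : Place K)) 1) :=
      congrArg (fun w ↦ s • w) h0
    rwa [smul_smul, hss, one_smul, smul_zero] at h1

end Summit.BirchSwinnertonDyer.BirchSwinnertonDyer.Theorems.KolyvaginAtTwo.RegularRefill

end
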